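import Mathlib
import Summits.Ventures.PercRepro2.TypedCountJoin

/-!
# Leaf functionals and single-edge configurations
(blind cell PercRepro2, night-3 g26, 2026-08-29; `proofs/NIGHT3-CERT.md` §35.6)

Bookkeeping for the bridge identity of `TypedCountBridge.lean`:

* `star w F Y` — the **leaf functional** `F*_Y(X) = F((X ∖ {w}) ∪ Y)` for `w ∈ X`, `F(X)` otherwise
  (monotone when `w ∈ Y`, `monotone_star`);
* `one e₀` — the configuration opening exactly `e₀`; a configuration supported on `{e₀}` is `one e₀`
  or empty (`eq_one_or_zero_of_onS_singleton`), the cluster of `u` under `one e₀` with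
  `ends e₀ = {u, w}` is `{u, w}` (`cluster_one`), under the empty configuration `{u}`
  (`cluster_zero`);
* `sum_onS_singleton` — a sum over the configurations supported on `{e₀}` has two terms.

Own work; standard axioms.
-/

namespace Summit.Ventures.PercRepro2

namespace TypedDeletion

variable {V : Type*} {E : Type*}

/-! ## The leaf functionals -/

section Star

variable {R : Type*} [Preorder R]

open Classical in
/-- The leaf functional `F*_Y(X) = F((X ∖ {w}) ∪ Y)` for `w ∈ X`, `F(X)` otherwise. -/
noncomputable def star (w : V) (F : Set V → R) (Y : Set V) : Set V → R :=
  fun X => if w ∈ X then F ((X \ {w}) ∪ Y) else F X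

/-- The leaf functional of a monotone functional is monotone (for `w ∈ Y`). -/
lemma monotone_star (w : V) {F : Set V → R} (hF : Monotone F) {Y : Set V} (hwY : w ∈ Y) :
    Monotone (star w F Y) := by
  intro X X' hXX'
  unfold star
  by_cases hX : w ∈ X
  · have hX' : w ∈ X' := hXX' hX
    rw [if_pos hX, if_pos hX']
    exact hF (Set.union_subset_union_left _ (Set.sdiff_subset_sdiff_left hXX'))
  · rw [if_neg hX]
    by_cases hX' : w ∈ X'
    · rw [if_pos hX']
      refine hF ?_
      intro x hx
      by_cases hxw : x = w
      · subst hxw; exact Or.inr hwY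
      · exact Or.inl ⟨hXX' hx, by simpa using hxw⟩
    · rw [if_neg hX']
      exact hF hXX'

end Star

/-! ## The cluster of a single edge -/

section OneEdge

variable [DecidableEq E]

/-- The configuration opening exactly the edge `e₀`. -/
def one (e₀ : E) : Config E := fun e => decide (e = e₀)

/-- `one e₀` is supported on `{e₀}`. -/
lemma onS_one (e₀ : E) : OnS ({e₀} : Finset E) (one e₀) := by
  intro e he
  simp only [one, decide_eq_true_eq] at he
  simp [he]

/-- A configuration supported on `{e₀}` is `one e₀` or the empty configuration. -/
lemma eq_one_or_zero_of_onS_singleton {e₀ : E} {ε : Config E} (h : OnS ({e₀} : Finset E) ε) :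
    ε = one e₀ ∨ ε = fun _ => false := by
  by_cases h0 : ε e₀ = true
  · left
    funext e
    simp only [one]
    by_cases he : e = e₀
    · subst he; simp [h0]
    · have : ε e = false := by
        by_contra hc
        have := h e (by simpa using hc)
        simp at this
        exact he this
      simp [he, this]
  · right
    funext e
    by_cases he : e = e₀
    · subst he; simpa using h0
    · by_contra hc
      have := h e (by simpa using hc)
      simp at this
      exact he this

omit [DecidableEq E] in
/-- The cluster of `u` under `one e₀`, `ends e₀ = {u, w}`, is `{u, w}`. -/
lemma cluster_one {ends : E → Sym2 V} {e₀ : E} {u w : V} (he₀ : ends e₀ = s(u, w)) [DecidableEq E] :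
    cluster ends (one e₀) u = {u, w} := by
  apply Set.Subset.antisymm
  · refine cluster_subset_of_closed (Set.mem_insert u _) ?_
    intro e x y he hxy _
    simp only [one, decide_eq_true_eq] at he
    subst he
    have hy : y ∈ ends e := by rw [hxy]; exact Sym2.mem_mk_right x y
    rw [he₀, Sym2.mem_iff] at hy
    rcases hy with rfl | rfl
    · exact Set.mem_insert _ _
    · exact Set.mem_insert_of_mem _ rfl
  · intro x hx
    rcases hx with rfl | hx
    · exact mem_cluster_self _ _ _
    · rw [Set.mem_singleton_iff] at hx
      subst hx
      exact conn_of_openAdj ⟨e₀, by simp [one], he₀⟩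

omit [DecidableEq E] in
/-- The cluster of `u` under the empty configuration is `{u}`. -/
lemma cluster_zero (ends : E → Sym2 V) (u : V) : cluster ends (fun _ => false) u = {u} := by
  apply Set.Subset.antisymm
  · refine cluster_subset_of_closed rfl ?_
    intro e _ _ he
    simp at he
  · intro x hx
    rw [Set.mem_singleton_iff] at hx
    subst hx
    exact mem_cluster_self _ _ _

end OneEdge

/-! ## Sums over the configurations supported on a single edge -/

section OneEdgeSum

variable [Fintype E] [DecidableEq E] {R : Type*} [CommRing R]

open Classical in
/-- A sum over the configurations supported on `{e₀}` has two terms. -/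
lemma sum_onS_singleton (e₀ : E) (h : Config E → R) :
    ∑ ε : Config E, (if OnS ({e₀} : Finset E) ε then h ε else 0) =
      h (one e₀) + h (fun _ => false) := by
  rw [← Finset.sum_filter]
  have hset : (Finset.univ.filter fun ε : Config E => OnS ({e₀} : Finset E) ε) =
      {one e₀, fun _ => false} := by
    ext ε
    simp only [Finset.mem_filter, Finset.mem_univ, true_and, Finset.mem_insert,
      Finset.mem_singleton]
    constructor
    · exact eq_one_or_zero_of_onS_singleton
    · rintro (rfl | rfl)
      · exact onS_one e₀
      · intro e he; simp at he
  rw [hset, Finset.sum_pair]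
  intro heq
  have := congrFun heq e₀
  simp [one] at this

end OneEdgeSum

end TypedDeletion

end Summit.Ventures.PercRepro2
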